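import Summits.HodgeConjecture.HodgeConjecture.Theses.NoetherLefschetzOneUp
import Summits.HodgeConjecture.HodgeConjecture.Theorems.NoetherLefschetzOneUpMiddleReduction
import Summits.HodgeConjecture.HodgeConjecture.Theorems.NoetherLefschetzOneUpNetReduction
import Summits.HodgeConjecture.HodgeConjecture.Theorems.NoetherLefschetzOneUpSummitGrantedFourfoldsStubHodgeBelowLevel
import Summits.HodgeConjecture.HodgeConjecture.Theorems.NoetherLefschetzOneUpSummitGrantedFourfoldsStubVerticalOfBelow

/-!
# Skeleton v2 of the crux `SummitGrantedFourfolds` (stmt-HodgeConjecture-14600), line `birth`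
# (registered), RESHAPED by the lead along the net × regime cut — vertical factor cut to size

Crux `stmt-HodgeConjecture-14600` of route `NoetherLefschetzOneUp` (rank 4):

  `SummitGrantedFourfolds := HC(4;2,2) → ∀ n X, IsSmoothProjective n X →
     Nonempty (HodgeModel n X) ∧ ∀ p c, IsRationalClass c → IsOfHodgeType n X (2p) p p c →
       c ∈ algebraicClasses X p`     (`≡ HC(4;2,2) → HodgeConjecture`, `Iff.rfl`).

The registered birth skeleton (`Lines/birth.lean`, sha a8ff086b…) cut the open content — the middle
degree `(m,m)` of smooth projective `2m`-folds, `m ≥ 3` — along the dimension ladder only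
(`stub_sixfoldsGrantedFourfolds` = rung 3 granted rung 2, `stub_ladderFromEightfolds` = rungs `≥ 4`
granted all rungs below); both are open-problem-sized. This reshape (lead c1, 2026-08-17) keeps the
composition — strong induction on the level `m` over the proved floor (`algebraicClasses_zero`,
`LefschetzOneOne_holds`, the hypothesis HC(4;2,2)), then `Theorems.middleReduction_proof` (BFNP
Lemma 48) and `HodgeModels_holds` — and refines each rung `m ≥ 3` through a NET of `(2m-2)`-folds
over `ℙ²` on the `2m`-fold (a THEOREM of the tree, `exists_fiberNet_smoothBase_nonempty_holds`, with
the birational descent `mem_algebraicClasses_of_isBirational` / `Theorems.isBirational_blowDown`),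
exactly as the crux-strategist's certified line `Lines/netRegimeSplit.lean` (STRATEGY-CENSUS.md §1):
on the total space a rational `(m,m)`-class is handled as

* its class MODULO VERTICAL classes — `stub_sixfoldNetClasses` (rung 3, fed with HC(4;2,2); OPEN:
  the rank-2 crux `K3TypeNets` one level up, for all fibre types) and `stub_higherNetClasses`
  (rungs `≥ 4` granted all lower rungs; OPEN: the declared open boundary of the route) — verbatim the
  strategist's pieces `SixfoldNetClasses` / `HigherNetClasses`; and
* the VERTICAL classes (dying off `f⁻¹(T)`, `T ⊊ ℙ²` closed), which are algebraic by a THEOREM IN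
  PRINT all of whose inputs are now DISCHARGED in the tree, cut here into two worker-sized stubs:
  - `stub_hodgeBelowLevel` — the Hodge conjecture in EVERY dimension `d ≤ 2m - 1` (all
    codimensions) granted the middle levels `< m`: induction on `d`; below the middle the pencil
    step `mem_algebraicClasses_of_two_mul_le` (de Cataldo–Migliorini 2009 §4 / Thomas 2005 §2,
    PROVED), at the middle the granted level, above the middle hard Lefschetz
    (`nonempty_hardLefschetzNFold_holds` + `mem_algebraicClasses_of_lt_of_nonempty`, PROVED);
  - `stub_verticalOfBelow` — vertical rational `(m,m)`-classes on a smooth projective `2m`-fold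
    are algebraic granted the Hodge conjecture in all dimensions `< 2m`: Deligne Hodge III 8.2.8
    (`Deligne1974_ker_restrictCompl_eq_iSup_range_complexGysin_holds`, PROVED) + the semisimple
    lift (`Voisin2025_hodgeClass_lift_complexGysin_holds`, PROVED) + projective Hironaka
    (`Hironaka1964_projective_holds`), packaged as
    `mem_iSup_map_complexGysin_of_restrictCompl_eq_zero_of_ne_univ`, then Gysin images of
    algebraic classes are algebraic (`map_complexGysin_algebraicClasses_le`,
    `gysinMap_restrictCompl_eq_zero_of_field ℂ`).

`SummitGrantedFourfolds_of` (no `sorry`; axioms `propext` · `Classical.choice` · `Quot.sound`)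
assembles the four stubs and concludes the route decl BY NAME; `higherVerticalClasses_of_stubs`
records that the two vertical stubs give the strategist's piece `HigherVerticalClasses` verbatim, and
`birth_stub_*_of_stubs` that the four stubs give back the two registered birth stubs verbatim (the
reshape refines, it does not change, the line). `sorry` occurs only inside the `stub_*` theorems — after wave 1 (2026-08-17) only in the two NET stubs
(`stub_sixfoldNetClasses`, `stub_higherNetClasses`); stubs 3 and 4 are the landed Theorems by name.
-/

set_option linter.dupNamespace false

noncomputable section

namespace Summit.HodgeConjecture.HodgeConjecture.Cruxes.SummitGrantedFourfolds.Birth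

open CategoryTheory AlgebraicGeometry
open Literature.AlgebraicGeometry Literature.AlgebraicGeometry.Motives
open Literature.AlgebraicGeometry.HodgeTheory
open Summit.HodgeConjecture.HodgeConjecture.Theses.NoetherLefschetzOneUp

/-- **Stub 1 — sixfold net classes modulo vertical, granted `HC(4;2,2)`** (OPEN; verbatim the
strategist's piece `SixfoldNetClasses`): for every smooth projective complex sixfold `X` with a
surjective `f : X ⟶ ℙ²`, the span of the rational `(3,3)`-classes lies in `algebraicClasses X 3 ⊔ V_f`,
`V_f` the span of the rational `(3,3)`-classes vanishing on `X ∖ f⁻¹(T)` for some proper closed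
`T ⊊ ℙ²`. [Deligne2000; Arapura2022 §1; vanGeemen1994HodgeAV Thm 4.11; Markman2025SecantWeil] -/
theorem stub_sixfoldNetClasses :
    (∀ ⦃X : Literature.AlgebraicGeometry.Motives.SchemeOver ℂ⦄, Literature.AlgebraicGeometry.Motives.IsSmoothProjective 4 X → ∀ c : Literature.AlgebraicGeometry.HodgeTheory.complexBetti X (2 * 2), Literature.AlgebraicGeometry.HodgeTheory.IsRationalClass c → Literature.AlgebraicGeometry.HodgeTheory.IsOfHodgeType 4 X (2 * 2) 2 2 c → c ∈ Literature.AlgebraicGeometry.HodgeTheory.algebraicClasses X 2) → ∀ ⦃X : Literature.AlgebraicGeometry.Motives.SchemeOver ℂ⦄ (f : X ⟶ Literature.AlgebraicGeometry.Motives.projectiveSpace 2 ℂ), Literature.AlgebraicGeometry.Motives.IsSmoothProjective 6 X → Function.Surjective f.left.base → Submodule.span ℂ {c : Literature.AlgebraicGeometry.HodgeTheory.complexBetti X (2 * 3) | Literature.AlgebraicGeometry.HodgeTheory.IsRationalClass c ∧ Literature.AlgebraicGeometry.HodgeTheory.IsOfHodgeType 6 X (2 * 3) 3 3 c} ≤ Literature.AlgebraicGeometry.HodgeTheory.algebraicClasses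 X 3 ⊔ Submodule.span ℂ {c : Literature.AlgebraicGeometry.HodgeTheory.complexBetti X (2 * 3) | Literature.AlgebraicGeometry.HodgeTheory.IsRationalClass c ∧ Literature.AlgebraicGeometry.HodgeTheory.IsOfHodgeType 6 X (2 * 3) 3 3 c ∧ ∃ T : Set (Literature.AlgebraicGeometry.Motives.projectiveSpace 2 ℂ).left, IsClosed T ∧ T ≠ Set.univ ∧ Literature.AlgebraicGeometry.HodgeTheory.complexBetti.restrictCompl X (f.left.base ⁻¹' T) (2 * 3) c = 0} := by
  sorry

/-- **Stub 2 — net classes modulo vertical at every level `m ≥ 4`, granted all lower levels**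
(OPEN; verbatim the strategist's piece `HigherNetClasses`, the declared open boundary of the route in
ladder form). [Deligne2000; BrosnanFangNiePearlstein2009 Lemma 48; Arapura2022 §1] -/
theorem stub_higherNetClasses :
    ∀ ⦃m : ℕ⦄, 4 ≤ m → (∀ m' : ℕ, m' < m → ∀ ⦃X : Literature.AlgebraicGeometry.Motives.SchemeOver ℂ⦄, Literature.AlgebraicGeometry.Motives.IsSmoothProjective (2 * m') X → ∀ c : Literature.AlgebraicGeometry.HodgeTheory.complexBetti X (2 * m'), Literature.AlgebraicGeometry.HodgeTheory.IsRationalClass c → Literature.AlgebraicGeometry.HodgeTheory.IsOfHodgeType (2 * m') X (2 * m') m' m' c → c ∈ Literature.AlgebraicGeometry.HodgeTheory.algebraicClasses X m') → ∀ ⦃X : Literature.AlgebraicGeometry.Motives.SchemeOver ℂ⦄ (f : X ⟶ Literature.AlgebraicGeometry.Motives.projectiveSpace 2 ℂ), Literature.AlgebraicGeometry.Motives.IsSmoothProjective (2 * m) X → Function.Surjective f.left.base → Submodule.span ℂ {c : Literature.AlgebraicGeometry.HodgeTheory.complexBetti X (2 * m) | Literature.AlgebraicGeometry.HodgeTheory.IsRationalClass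 c ∧ Literature.AlgebraicGeometry.HodgeTheory.IsOfHodgeType (2 * m) X (2 * m) m m c} ≤ Literature.AlgebraicGeometry.HodgeTheory.algebraicClasses X m ⊔ Submodule.span ℂ {c : Literature.AlgebraicGeometry.HodgeTheory.complexBetti X (2 * m) | Literature.AlgebraicGeometry.HodgeTheory.IsRationalClass c ∧ Literature.AlgebraicGeometry.HodgeTheory.IsOfHodgeType (2 * m) X (2 * m) m m c ∧ ∃ T : Set (Literature.AlgebraicGeometry.Motives.projectiveSpace 2 ℂ).left, IsClosed T ∧ T ≠ Set.univ ∧ Literature.AlgebraicGeometry.HodgeTheory.complexBetti.restrictCompl X (f.left.base ⁻¹' T) (2 * m) c = 0} := by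
  sorry

/-- **Stub 3 — the Hodge conjecture in every dimension `< 2m`, granted the middle levels `< m`**
(PRINT — LANDED p149630, `Theorems.stub_hodgeBelowLevel`; BFNP Lemma 48 truncated at level `m`): if every rational `(m',m')`-class on
every smooth projective `2m'`-fold is algebraic for all `m' < m`, then on every smooth projective
complex variety `X` of dimension `d < 2m` every rational `(p,p)`-class, every `p`, lies in
`algebraicClasses X p`. Proof in print / in tree: induction on `d`; `2p ≤ d - 1` by the pencil step
`mem_algebraicClasses_of_two_mul_le` from dimension `d - 1`; `2p = d` is the granted level `d/2 < m`;
`2p > d` by hard Lefschetz `mem_algebraicClasses_of_lt_of_nonempty (nonempty_hardLefschetzNFold_holds d X)`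
from degree `2(d - p) < d`. [BrosnanFangNiePearlstein2009 Lemma 48; DecataldoMigliorini2009 §4
Prop. 4.5; Thomas2005Nodes §2 Prop. 2; VoisinHodgeI2002 Thm. 6.25] -/
theorem stub_hodgeBelowLevel :
    ∀ ⦃m : ℕ⦄, (∀ m' : ℕ, m' < m → ∀ ⦃X : Literature.AlgebraicGeometry.Motives.SchemeOver ℂ⦄, Literature.AlgebraicGeometry.Motives.IsSmoothProjective (2 * m') X → ∀ c : Literature.AlgebraicGeometry.HodgeTheory.complexBetti X (2 * m'), Literature.AlgebraicGeometry.HodgeTheory.IsRationalClass c → Literature.AlgebraicGeometry.HodgeTheory.IsOfHodgeType (2 * m') X (2 * m') m' m' c → c ∈ Literature.AlgebraicGeometry.HodgeTheory.algebraicClasses X m') → ∀ ⦃d : ℕ⦄, d < 2 * m → ∀ ⦃X : Literature.AlgebraicGeometry.Motives.SchemeOver ℂ⦄, Literature.AlgebraicGeometry.Motives.IsSmoothProjective d X → ∀ (p : ℕ) (c : Literature.AlgebraicGeometry.HodgeTheory.complexBetti X (2 * p)), Literature.AlgebraicGeometry.HodgeTheory.IsRationalClass c → Literature.AlgebraicGeometry.HodgeTheory.IsOfHodgeType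 d X (2 * p) p p c → c ∈ Literature.AlgebraicGeometry.HodgeTheory.algebraicClasses X p :=
  -- LANDED p149630 (wave 1): Theorems/NoetherLefschetzOneUpSummitGrantedFourfoldsStubHodgeBelowLevel.lean
  Summit.HodgeConjecture.HodgeConjecture.Theorems.stub_hodgeBelowLevel

/-- **Stub 4 — vertical classes are algebraic, granted the Hodge conjecture below the dimension**
(PRINT — LANDED p149073, `Theorems.stub_verticalOfBelow`): for `X` smooth projective of dimension `2m` and `f : X ⟶ ℙ²` surjective on
points, if every rational `(p,p)`-class on every smooth projective variety of dimension `< 2m` is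
algebraic, then the span of the rational `(m,m)`-classes dying on `(X ∖ f⁻¹T)(ℂ)` for some proper
closed `T ⊊ ℙ²` lies in `algebraicClasses X m`. Proof in print / in tree: `f⁻¹T` is a proper closed
subset, so such a class is a `ℂ`-combination of Gysin images `g_* b`, `g : W ⟶ X`, `W` smooth
projective of dimension `2m - e`, `1 ≤ e`, `b` rational of type `(m - e, m - e)`
(`mem_iSup_map_complexGysin_of_restrictCompl_eq_zero_of_ne_univ` fed with
`Deligne1974_ker_restrictCompl_eq_iSup_range_complexGysin_holds`,
`Voisin2025_hodgeClass_lift_complexGysin_holds`, `Resolution.Hironaka1964_projective_holds`, an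
orientation family from `Motives.ComplexPoints.isOrientableOver` and
`OrientationFamily.hasPoincareDuality`); each `b` is algebraic by hypothesis (`dim W < 2m`), and
`g_*` maps `algebraicClasses W (m - e)` into `algebraicClasses X m`
(`map_complexGysin_algebraicClasses_le (gysinMap_restrictCompl_eq_zero_of_field ℂ)`).
[DeligneHodgeIII1974 Cor. 8.2.8; Voisin2025 Cor. 2.12; Voisin2013GHCBloch Lemma 2.1 (proof);
Kollar2007 Thm. 3.27] -/
theorem stub_verticalOfBelow :
    ∀ ⦃m : ℕ⦄, (∀ ⦃d : ℕ⦄, d < 2 * m → ∀ ⦃W : Literature.AlgebraicGeometry.Motives.SchemeOver ℂ⦄, Literature.AlgebraicGeometry.Motives.IsSmoothProjective d W → ∀ (p : ℕ) (b : Literature.AlgebraicGeometry.HodgeTheory.complexBetti W (2 * p)), Literature.AlgebraicGeometry.HodgeTheory.IsRationalClass b → Literature.AlgebraicGeometry.HodgeTheory.IsOfHodgeType d W (2 * p) p p b → b ∈ Literature.AlgebraicGeometry.HodgeTheory.algebraicClasses W p) → ∀ ⦃X : Literature.AlgebraicGeometry.Motives.SchemeOver ℂ⦄ (f : X ⟶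 Literature.AlgebraicGeometry.Motives.projectiveSpace 2 ℂ), Literature.AlgebraicGeometry.Motives.IsSmoothProjective (2 * m) X → Function.Surjective f.left.base → Submodule.span ℂ {c : Literature.AlgebraicGeometry.HodgeTheory.complexBetti X (2 * m) | Literature.AlgebraicGeometry.HodgeTheory.IsRationalClass c ∧ Literature.AlgebraicGeometry.HodgeTheory.IsOfHodgeType (2 * m) X (2 * m) m m c ∧ ∃ T : Set (Literature.AlgebraicGeometry.Motives.projectiveSpace 2 ℂ).left, IsClosed T ∧ T ≠ Set.univ ∧ Literature.AlgebraicGeometry.HodgeTheory.complexBetti.restrictCompl X (f.left.base ⁻¹' T) (2 * m) c = 0} ≤ Literature.AlgebraicGeometry.HodgeTheory.algebraicClasses X m :=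
  -- LANDED p149073 (wave 1): Theorems/NoetherLefschetzOneUpSummitGrantedFourfoldsStubVerticalOfBelow.lean
  Summit.HodgeConjecture.HodgeConjecture.Theorems.stub_verticalOfBelow

/-- **The strategist's piece `HigherVerticalClasses` from stubs 3 and 4** (no `sorry` of its own):
vertical rational `(m,m)`-classes are algebraic at every level `m ≥ 3` granted all lower levels —
the lower levels give the Hodge conjecture in every dimension `< 2m` (stub 3), which feeds the
descent of vertical classes (stub 4). Statement verbatim `Lines/netRegimeSplit.lean`,
`stub_higherVerticalClasses`. -/
theorem higherVerticalClasses_of_stubs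
    (hB : ∀ ⦃m : ℕ⦄, (∀ m' : ℕ, m' < m → ∀ ⦃X : Literature.AlgebraicGeometry.Motives.SchemeOver ℂ⦄, Literature.AlgebraicGeometry.Motives.IsSmoothProjective (2 * m') X → ∀ c : Literature.AlgebraicGeometry.HodgeTheory.complexBetti X (2 * m'), Literature.AlgebraicGeometry.HodgeTheory.IsRationalClass c → Literature.AlgebraicGeometry.HodgeTheory.IsOfHodgeType (2 * m') X (2 * m') m' m' c → c ∈ Literature.AlgebraicGeometry.HodgeTheory.algebraicClasses X m') → ∀ ⦃d : ℕ⦄, d < 2 * m → ∀ ⦃X : Literature.AlgebraicGeometry.Motives.SchemeOver ℂ⦄, Literature.AlgebraicGeometry.Motives.IsSmoothProjective d X → ∀ (p : ℕ) (c : Literature.AlgebraicGeometry.HodgeTheory.complexBetti X (2 * p)), Literature.AlgebraicGeometry.HodgeTheory.IsRationalClass c → Literature.AlgebraicGeometry.HodgeTheory.IsOfHodgeType d X (2 * p) p p c → c ∈ Literature.AlgebraicGeometry.HodgeTheory.algebraicClasses X p)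
    (hD : ∀ ⦃m : ℕ⦄, (∀ ⦃d : ℕ⦄, d < 2 * m → ∀ ⦃W : Literature.AlgebraicGeometry.Motives.SchemeOver ℂ⦄, Literature.AlgebraicGeometry.Motives.IsSmoothProjective d W → ∀ (p : ℕ) (b : Literature.AlgebraicGeometry.HodgeTheory.complexBetti W (2 * p)), Literature.AlgebraicGeometry.HodgeTheory.IsRationalClass b → Literature.AlgebraicGeometry.HodgeTheory.IsOfHodgeType d W (2 * p) p p b → b ∈ Literature.AlgebraicGeometry.HodgeTheory.algebraicClasses W p) → ∀ ⦃X : Literature.AlgebraicGeometry.Motives.SchemeOver ℂ⦄ (f : X ⟶ Literature.AlgebraicGeometry.Motives.projectiveSpace 2 ℂ), Literature.AlgebraicGeometry.Motives.IsSmoothProjective (2 * m) X → Function.Surjective f.left.base → Submodule.span ℂ {c : Literature.AlgebraicGeometry.HodgeTheory.complexBetti X (2 * m) | Literature.AlgebraicGeometry.HodgeTheory.IsRationalClass c ∧ Literature.AlgebraicGeometry.HodgeTheory.IsOfHodgeType (2 * m) X (2 * m) m m c ∧ ∃ T : Set (Literature.AlgebraicGeometry.Motives.projectiveSpace 2 ℂ).left,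 IsClosed T ∧ T ≠ Set.univ ∧ Literature.AlgebraicGeometry.HodgeTheory.complexBetti.restrictCompl X (f.left.base ⁻¹' T) (2 * m) c = 0} ≤ Literature.AlgebraicGeometry.HodgeTheory.algebraicClasses X m) :
    ∀ ⦃m : ℕ⦄, 3 ≤ m → (∀ m' : ℕ, m' < m → ∀ ⦃X : Literature.AlgebraicGeometry.Motives.SchemeOver ℂ⦄, Literature.AlgebraicGeometry.Motives.IsSmoothProjective (2 * m') X → ∀ c : Literature.AlgebraicGeometry.HodgeTheory.complexBetti X (2 * m'), Literature.AlgebraicGeometry.HodgeTheory.IsRationalClass c → Literature.AlgebraicGeometry.HodgeTheory.IsOfHodgeType (2 * m') X (2 * m') m' m' c → c ∈ Literature.AlgebraicGeometry.HodgeTheory.algebraicClasses X m') → ∀ ⦃X : Literature.AlgebraicGeometry.Motives.SchemeOver ℂ⦄ (f : X ⟶ Literature.AlgebraicGeometry.Motives.projectiveSpace 2 ℂ), Literature.AlgebraicGeometry.Motives.IsSmoothProjective (2 * m) X → Function.Surjective f.left.base → Submodule.span ℂ {c : Literature.AlgebraicGeometry.HodgeTheory.complexBetti X (2 * m) | Literature.AlgebraicGeometry.HodgeTheory.IsRationalClass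 c ∧ Literature.AlgebraicGeometry.HodgeTheory.IsOfHodgeType (2 * m) X (2 * m) m m c ∧ ∃ T : Set (Literature.AlgebraicGeometry.Motives.projectiveSpace 2 ℂ).left, IsClosed T ∧ T ≠ Set.univ ∧ Literature.AlgebraicGeometry.HodgeTheory.complexBetti.restrictCompl X (f.left.base ⁻¹' T) (2 * m) c = 0} ≤ Literature.AlgebraicGeometry.HodgeTheory.algebraicClasses X m :=
  fun _ _ ih _ f hX hf ↦ hD (hB ih) f hX hf

/-- **Assembly, implication form** (kernel-checked, no `sorry`): the four stubs imply the crux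
`NoetherLefschetzOneUp.SummitGrantedFourfolds` — strong induction on the level `m`; floor `m = 0`
(`algebraicClasses_zero`), `m = 1` (`LefschetzOneOne_holds`), `m = 2` (the crux's hypothesis);
`m ≥ 3`: a net of `(2m-2)`-folds over `ℙ²` on the `2m`-fold (`exists_fiberNet_smoothBase_nonempty_holds`),
the net stub of the level (stub 1 at `m = 3`, stub 2 at `m ≥ 4`) and the vertical classes on its total
space (stubs 3 + 4, `higherVerticalClasses_of_stubs`), birational descent along the blow-down
(`Theorems.isBirational_blowDown`, `mem_algebraicClasses_of_isBirational`); then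
`Theorems.middleReduction_proof` (BFNP Lemma 48) and `HodgeModels_holds`. The composition is the
strategist's certified glue `Lines/netRegimeSplit.lean` `SummitGrantedFourfolds_of`, with its third
hypothesis supplied by `higherVerticalClasses_of_stubs`. -/
theorem SummitGrantedFourfolds_of
    (h6 : (∀ ⦃X : Literature.AlgebraicGeometry.Motives.SchemeOver ℂ⦄, Literature.AlgebraicGeometry.Motives.IsSmoothProjective 4 X → ∀ c : Literature.AlgebraicGeometry.HodgeTheory.complexBetti X (2 * 2), Literature.AlgebraicGeometry.HodgeTheory.IsRationalClass c → Literature.AlgebraicGeometry.HodgeTheory.IsOfHodgeType 4 X (2 * 2) 2 2 c → c ∈ Literature.AlgebraicGeometry.HodgeTheory.algebraicClasses X 2) → ∀ ⦃X : Literature.AlgebraicGeometry.Motives.SchemeOver ℂ⦄ (f : X ⟶ Literature.AlgebraicGeometry.Motives.projectiveSpace 2 ℂ), Literature.AlgebraicGeometry.Motives.IsSmoothProjective 6 X → Function.Surjective f.left.base → Submodule.span ℂ {c : Literature.AlgebraicGeometry.HodgeTheory.complexBetti X (2 * 3) | Literature.AlgebraicGeometry.HodgeTheory.IsRationalClass c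 ∧ Literature.AlgebraicGeometry.HodgeTheory.IsOfHodgeType 6 X (2 * 3) 3 3 c} ≤ Literature.AlgebraicGeometry.HodgeTheory.algebraicClasses X 3 ⊔ Submodule.span ℂ {c : Literature.AlgebraicGeometry.HodgeTheory.complexBetti X (2 * 3) | Literature.AlgebraicGeometry.HodgeTheory.IsRationalClass c ∧ Literature.AlgebraicGeometry.HodgeTheory.IsOfHodgeType 6 X (2 * 3) 3 3 c ∧ ∃ T : Set (Literature.AlgebraicGeometry.Motives.projectiveSpace 2 ℂ).left, IsClosed T ∧ T ≠ Set.univ ∧ Literature.AlgebraicGeometry.HodgeTheory.complexBetti.restrictCompl X (f.left.base ⁻¹' T) (2 * 3) c = 0})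
    (hN : ∀ ⦃m : ℕ⦄, 4 ≤ m → (∀ m' : ℕ, m' < m → ∀ ⦃X : Literature.AlgebraicGeometry.Motives.SchemeOver ℂ⦄, Literature.AlgebraicGeometry.Motives.IsSmoothProjective (2 * m') X → ∀ c : Literature.AlgebraicGeometry.HodgeTheory.complexBetti X (2 * m'), Literature.AlgebraicGeometry.HodgeTheory.IsRationalClass c → Literature.AlgebraicGeometry.HodgeTheory.IsOfHodgeType (2 * m') X (2 * m') m' m' c → c ∈ Literature.AlgebraicGeometry.HodgeTheory.algebraicClasses X m') → ∀ ⦃X : Literature.AlgebraicGeometry.Motives.SchemeOver ℂ⦄ (f : X ⟶ Literature.AlgebraicGeometry.Motives.projectiveSpace 2 ℂ), Literature.AlgebraicGeometry.Motives.IsSmoothProjective (2 * m) X → Function.Surjective f.left.base → Submodule.span ℂ {c : Literature.AlgebraicGeometry.HodgeTheory.complexBetti X (2 * m) | Literature.AlgebraicGeometry.HodgeTheory.IsRationalClass c ∧ Literature.AlgebraicGeometry.HodgeTheory.IsOfHodgeType (2 * m) X (2 * m) m m c} ≤ Literature.AlgebraicGeometry.HodgeTheory.algebraicClasses X m ⊔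 Submodule.span ℂ {c : Literature.AlgebraicGeometry.HodgeTheory.complexBetti X (2 * m) | Literature.AlgebraicGeometry.HodgeTheory.IsRationalClass c ∧ Literature.AlgebraicGeometry.HodgeTheory.IsOfHodgeType (2 * m) X (2 * m) m m c ∧ ∃ T : Set (Literature.AlgebraicGeometry.Motives.projectiveSpace 2 ℂ).left, IsClosed T ∧ T ≠ Set.univ ∧ Literature.AlgebraicGeometry.HodgeTheory.complexBetti.restrictCompl X (f.left.base ⁻¹' T) (2 * m) c = 0})
    (hB : ∀ ⦃m : ℕ⦄, (∀ m' : ℕ, m' < m → ∀ ⦃X : Literature.AlgebraicGeometry.Motives.SchemeOver ℂ⦄, Literature.AlgebraicGeometry.Motives.IsSmoothProjective (2 * m') X → ∀ c : Literature.AlgebraicGeometry.HodgeTheory.complexBetti X (2 * m'), Literature.AlgebraicGeometry.HodgeTheory.IsRationalClass c → Literature.AlgebraicGeometry.HodgeTheory.IsOfHodgeType (2 * m') X (2 * m') m' m' c → c ∈ Literature.AlgebraicGeometry.HodgeTheory.algebraicClasses X m') → ∀ ⦃d : ℕ⦄, d < 2 * m → ∀ ⦃X : Literature.AlgebraicGeometry.Motives.SchemeOver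 ℂ⦄, Literature.AlgebraicGeometry.Motives.IsSmoothProjective d X → ∀ (p : ℕ) (c : Literature.AlgebraicGeometry.HodgeTheory.complexBetti X (2 * p)), Literature.AlgebraicGeometry.HodgeTheory.IsRationalClass c → Literature.AlgebraicGeometry.HodgeTheory.IsOfHodgeType d X (2 * p) p p c → c ∈ Literature.AlgebraicGeometry.HodgeTheory.algebraicClasses X p)
    (hD : ∀ ⦃m : ℕ⦄, (∀ ⦃d : ℕ⦄, d < 2 * m → ∀ ⦃W : Literature.AlgebraicGeometry.Motives.SchemeOver ℂ⦄, Literature.AlgebraicGeometry.Motives.IsSmoothProjective d W → ∀ (p : ℕ) (b : Literature.AlgebraicGeometry.HodgeTheory.complexBetti W (2 * p)), Literature.AlgebraicGeometry.HodgeTheory.IsRationalClass b → Literature.AlgebraicGeometry.HodgeTheory.IsOfHodgeType d W (2 * p) p p b → b ∈ Literature.AlgebraicGeometry.HodgeTheory.algebraicClasses W p) → ∀ ⦃X : Literature.AlgebraicGeometry.Motives.SchemeOver ℂ⦄ (f : X ⟶ Literature.AlgebraicGeometry.Motives.projectiveSpace 2 ℂ), Literature.AlgebraicGeometry.Motives.IsSmoothProjective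 (2 * m) X → Function.Surjective f.left.base → Submodule.span ℂ {c : Literature.AlgebraicGeometry.HodgeTheory.complexBetti X (2 * m) | Literature.AlgebraicGeometry.HodgeTheory.IsRationalClass c ∧ Literature.AlgebraicGeometry.HodgeTheory.IsOfHodgeType (2 * m) X (2 * m) m m c ∧ ∃ T : Set (Literature.AlgebraicGeometry.Motives.projectiveSpace 2 ℂ).left, IsClosed T ∧ T ≠ Set.univ ∧ Literature.AlgebraicGeometry.HodgeTheory.complexBetti.restrictCompl X (f.left.base ⁻¹' T) (2 * m) c = 0} ≤ Literature.AlgebraicGeometry.HodgeTheory.algebraicClasses X m) :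
    Summit.HodgeConjecture.HodgeConjecture.Theses.NoetherLefschetzOneUp.SummitGrantedFourfolds := by
  have hV := higherVerticalClasses_of_stubs hB hD
  unfold Summit.HodgeConjecture.HodgeConjecture.Theses.NoetherLefschetzOneUp.SummitGrantedFourfolds
  intro h42 n X hX
  -- every middle degree, by strong induction on the level `m`
  have hmid : ∀ m : ℕ, ∀ ⦃Y : SchemeOver ℂ⦄, IsSmoothProjective (2 * m) Y →
      ∀ c : complexBetti Y (2 * m), IsRationalClass c →
        IsOfHodgeType (2 * m) Y (2 * m) m m c → c ∈ algebraicClasses Y m := by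
    intro m
    induction m using Nat.strong_induction_on with
    | _ m ih =>
      obtain hm | hm := Nat.lt_or_ge m 3
      · interval_cases m
        · -- level 0: `N⁰ H⁰ = H⁰`
          intro Y _ c _ _
          rw [algebraicClasses_zero]
          exact Submodule.mem_top
        · -- level 1: Lefschetz (1,1) on surfaces (proved support item)
          exact fun Y hY c hc hpp ↦ LefschetzOneOne_holds hY c hc hpp
        · -- level 2: the crux's hypothesis HC(4;2,2)
          exact fun Y hY c hc hpp ↦ h42 hY c hc hpp
      · -- level m ≥ 3: enter through a net of (2m-2)-folds over ℙ² (tree theorem), split the class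
        -- on the total space into net part + vertical part, descend along the blow-down (tree theorem)
        intro Y hY c hc hpp
        obtain ⟨k, rfl⟩ : ∃ k, m = k + 1 := ⟨m - 1, by omega⟩
        have e : 2 + 2 * k = 2 * (k + 1) := by ring
        have hY' : IsSmoothProjective (2 + 2 * k) Y := e ▸ hY
        obtain ⟨N, -⟩ := exists_fiberNet_smoothBase_nonempty_holds (2 * k) 2 (by omega) hY'
        have htot : IsSmoothProjective (2 * (k + 1)) N.total := e ▸ N.isSmoothProjective_total
        refine mem_algebraicClasses_of_isBirational htot hY N.blowDown
          (Summit.HodgeConjecture.HodgeConjecture.Theorems.isBirational_blowDown hY' N) ?_ c hc hpp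
        intro c' hc' hpp'
        have hv := hV hm ih N.proj htot (FiberNet.surjective_proj N)
        obtain hk | hk := Nat.lt_or_ge (k + 1) 4
        · -- level 3: the sixfold net piece, fed with HC(4;2,2)
          obtain rfl : k = 2 := by omega
          have h1 := h6 h42 N.proj htot (FiberNet.surjective_proj N)
          exact (sup_le le_rfl hv) (h1 (Submodule.subset_span ⟨hc', hpp'⟩))
        · -- level ≥ 4: the higher net piece, fed with all lower levels
          have h1 := hN hk ih N.proj htot (FiberNet.surjective_proj N)
          exact (sup_le le_rfl hv) (h1 (Submodule.subset_span ⟨hc', hpp'⟩))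
  -- conjunct 1: Hodge models (proved support item); conjunct 2: BFNP reduction (proved support item)
  exact ⟨HodgeModels_holds hX,
    Summit.HodgeConjecture.HodgeConjecture.Theorems.middleReduction_proof
      (fun m Y hY c hc hpp ↦ hmid m hY c hc hpp) hX⟩

/-- **The crux from its registered stubs, by name** (no `sorry` of its own; its closure is
conditional on the four `stub_*` placeholders until they are proved). -/
theorem SummitGrantedFourfolds_of_stubs :
    Summit.HodgeConjecture.HodgeConjecture.Theses.NoetherLefschetzOneUp.SummitGrantedFourfolds :=
  SummitGrantedFourfolds_of stub_sixfoldNetClasses stub_higherNetClasses stub_hodgeBelowLevel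
    stub_verticalOfBelow

/-! ### Bridge back to the registered birth stubs

The reshape REFINES the registered line: its two stubs (restated verbatim from `Lines/birth.lean`,
sha a8ff086b…) follow from the four new ones — rung 3 from stubs 1, 3, 4; rungs `≥ 4` from stubs
2, 3, 4 — by the `m = 3` / `m ≥ 4` branches of `SummitGrantedFourfolds_of`. -/

/-- `birth.stub_sixfoldsGrantedFourfolds` (HC(4;2,2) → every rational `(3,3)`-class on every smooth
projective sixfold is algebraic) from stubs 1, 3, 4 (no `sorry` of its own). -/
theorem birth_stub_sixfoldsGrantedFourfolds_of_stubs
    (h6 : (∀ ⦃X : Literature.AlgebraicGeometry.Motives.SchemeOver ℂ⦄, Literature.AlgebraicGeometry.Motives.IsSmoothProjective 4 X → ∀ c : Literature.AlgebraicGeometry.HodgeTheory.complexBetti X (2 * 2), Literature.AlgebraicGeometry.HodgeTheory.IsRationalClass c → Literature.AlgebraicGeometry.HodgeTheory.IsOfHodgeType 4 X (2 * 2) 2 2 c → c ∈ Literature.AlgebraicGeometry.HodgeTheory.algebraicClasses X 2) → ∀ ⦃X : Literature.AlgebraicGeometry.Motives.SchemeOver ℂ⦄ (f : X ⟶ Literature.AlgebraicGeometry.Motives.projectiveSpace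 2 ℂ), Literature.AlgebraicGeometry.Motives.IsSmoothProjective 6 X → Function.Surjective f.left.base → Submodule.span ℂ {c : Literature.AlgebraicGeometry.HodgeTheory.complexBetti X (2 * 3) | Literature.AlgebraicGeometry.HodgeTheory.IsRationalClass c ∧ Literature.AlgebraicGeometry.HodgeTheory.IsOfHodgeType 6 X (2 * 3) 3 3 c} ≤ Literature.AlgebraicGeometry.HodgeTheory.algebraicClasses X 3 ⊔ Submodule.span ℂ {c : Literature.AlgebraicGeometry.HodgeTheory.complexBetti X (2 * 3) | Literature.AlgebraicGeometry.HodgeTheory.IsRationalClass c ∧ Literature.AlgebraicGeometry.HodgeTheory.IsOfHodgeType 6 X (2 * 3) 3 3 c ∧ ∃ T : Set (Literature.AlgebraicGeometry.Motives.projectiveSpace 2 ℂ).left, IsClosed T ∧ T ≠ Set.univ ∧ Literature.AlgebraicGeometry.HodgeTheory.complexBetti.restrictCompl X (f.left.base ⁻¹' T) (2 * 3) c = 0})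
    (hB : ∀ ⦃m : ℕ⦄, (∀ m' : ℕ, m' < m → ∀ ⦃X : Literature.AlgebraicGeometry.Motives.SchemeOver ℂ⦄, Literature.AlgebraicGeometry.Motives.IsSmoothProjective (2 * m') X → ∀ c : Literature.AlgebraicGeometry.HodgeTheory.complexBetti X (2 * m'), Literature.AlgebraicGeometry.HodgeTheory.IsRationalClass c → Literature.AlgebraicGeometry.HodgeTheory.IsOfHodgeType (2 * m') X (2 * m') m' m' c → c ∈ Literature.AlgebraicGeometry.HodgeTheory.algebraicClasses X m') → ∀ ⦃d : ℕ⦄, d < 2 * m → ∀ ⦃X : Literature.AlgebraicGeometry.Motives.SchemeOver ℂ⦄, Literature.AlgebraicGeometry.Motives.IsSmoothProjective d X → ∀ (p : ℕ) (c : Literature.AlgebraicGeometry.HodgeTheory.complexBetti X (2 * p)), Literature.AlgebraicGeometry.HodgeTheory.IsRationalClass c → Literature.AlgebraicGeometry.HodgeTheory.IsOfHodgeType d X (2 * p) p p c → c ∈ Literature.AlgebraicGeometry.HodgeTheory.algebraicClasses X p)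
    (hD : ∀ ⦃m : ℕ⦄, (∀ ⦃d : ℕ⦄, d < 2 * m → ∀ ⦃W : Literature.AlgebraicGeometry.Motives.SchemeOver ℂ⦄, Literature.AlgebraicGeometry.Motives.IsSmoothProjective d W → ∀ (p : ℕ) (b : Literature.AlgebraicGeometry.HodgeTheory.complexBetti W (2 * p)), Literature.AlgebraicGeometry.HodgeTheory.IsRationalClass b → Literature.AlgebraicGeometry.HodgeTheory.IsOfHodgeType d W (2 * p) p p b → b ∈ Literature.AlgebraicGeometry.HodgeTheory.algebraicClasses W p) → ∀ ⦃X : Literature.AlgebraicGeometry.Motives.SchemeOver ℂ⦄ (f : X ⟶ Literature.AlgebraicGeometry.Motives.projectiveSpace 2 ℂ), Literature.AlgebraicGeometry.Motives.IsSmoothProjective (2 * m) X → Function.Surjective f.left.base → Submodule.span ℂ {c : Literature.AlgebraicGeometry.HodgeTheory.complexBetti X (2 * m) | Literature.AlgebraicGeometry.HodgeTheory.IsRationalClass c ∧ Literature.AlgebraicGeometry.HodgeTheory.IsOfHodgeType (2 * m) X (2 * m) m m c ∧ ∃ T : Set (Literature.AlgebraicGeometry.Motives.projectiveSpace 2 ℂ).left,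 IsClosed T ∧ T ≠ Set.univ ∧ Literature.AlgebraicGeometry.HodgeTheory.complexBetti.restrictCompl X (f.left.base ⁻¹' T) (2 * m) c = 0} ≤ Literature.AlgebraicGeometry.HodgeTheory.algebraicClasses X m) :
    (∀ ⦃X : SchemeOver ℂ⦄, IsSmoothProjective 4 X → ∀ c : complexBetti X (2 * 2),
      IsRationalClass c → IsOfHodgeType 4 X (2 * 2) 2 2 c → c ∈ algebraicClasses X 2) →
    ∀ ⦃X : SchemeOver ℂ⦄, IsSmoothProjective 6 X → ∀ c : complexBetti X (2 * 3),
      IsRationalClass c → IsOfHodgeType 6 X (2 * 3) 3 3 c → c ∈ algebraicClasses X 3 := by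
  have hV := higherVerticalClasses_of_stubs hB hD
  intro h42 Y hY c hc hpp
  -- the lower levels 0, 1, 2 (theorems + the hypothesis)
  have ih : ∀ m' : ℕ, m' < 3 → ∀ ⦃X : SchemeOver ℂ⦄, IsSmoothProjective (2 * m') X →
      ∀ c : complexBetti X (2 * m'), IsRationalClass c →
        IsOfHodgeType (2 * m') X (2 * m') m' m' c → c ∈ algebraicClasses X m' := by
    intro m' hm'
    interval_cases m'
    · intro X _ c _ _
      rw [algebraicClasses_zero]
      exact Submodule.mem_top
    · exact fun X hX c hc hpp ↦ LefschetzOneOne_holds hX c hc hpp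
    · exact fun X hX c hc hpp ↦ h42 hX c hc hpp
  -- a net of fourfolds over ℙ² on the sixfold, the two pieces on its total space, birational descent
  have hY' : IsSmoothProjective (2 + 2 * 2) Y := hY
  obtain ⟨N, -⟩ := exists_fiberNet_smoothBase_nonempty_holds (2 * 2) 2 (by omega) hY'
  have htot : IsSmoothProjective (2 * 3) N.total := N.isSmoothProjective_total
  refine mem_algebraicClasses_of_isBirational htot hY N.blowDown
    (Summit.HodgeConjecture.HodgeConjecture.Theorems.isBirational_blowDown hY' N) ?_ c hc hpp
  intro c' hc' hpp'
  have hv := hV (show 3 ≤ 3 from le_rfl) ih N.proj htot (FiberNet.surjective_proj N)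
  have h1 := h6 h42 N.proj htot (FiberNet.surjective_proj N)
  exact (sup_le le_rfl hv) (h1 (Submodule.subset_span ⟨hc', hpp'⟩))

/-- `birth.stub_ladderFromEightfolds` (for `m ≥ 4`, the middle degree of all smooth projective
`2m`-folds granted all lower levels) from stubs 2, 3, 4 (no `sorry` of its own). -/
theorem birth_stub_ladderFromEightfolds_of_stubs
    (hN : ∀ ⦃m : ℕ⦄, 4 ≤ m → (∀ m' : ℕ, m' < m → ∀ ⦃X : Literature.AlgebraicGeometry.Motives.SchemeOver ℂ⦄, Literature.AlgebraicGeometry.Motives.IsSmoothProjective (2 * m') X → ∀ c : Literature.AlgebraicGeometry.HodgeTheory.complexBetti X (2 * m'), Literature.AlgebraicGeometry.HodgeTheory.IsRationalClass c → Literature.AlgebraicGeometry.HodgeTheory.IsOfHodgeType (2 * m') X (2 * m') m' m' c → c ∈ Literature.AlgebraicGeometry.HodgeTheory.algebraicClasses X m') → ∀ ⦃X : Literature.AlgebraicGeometry.Motives.SchemeOver ℂ⦄ (f : X ⟶ Literature.AlgebraicGeometry.Motives.projectiveSpace 2 ℂ), Literature.AlgebraicGeometry.Motives.IsSmoothProjective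 (2 * m) X → Function.Surjective f.left.base → Submodule.span ℂ {c : Literature.AlgebraicGeometry.HodgeTheory.complexBetti X (2 * m) | Literature.AlgebraicGeometry.HodgeTheory.IsRationalClass c ∧ Literature.AlgebraicGeometry.HodgeTheory.IsOfHodgeType (2 * m) X (2 * m) m m c} ≤ Literature.AlgebraicGeometry.HodgeTheory.algebraicClasses X m ⊔ Submodule.span ℂ {c : Literature.AlgebraicGeometry.HodgeTheory.complexBetti X (2 * m) | Literature.AlgebraicGeometry.HodgeTheory.IsRationalClass c ∧ Literature.AlgebraicGeometry.HodgeTheory.IsOfHodgeType (2 * m) X (2 * m) m m c ∧ ∃ T : Set (Literature.AlgebraicGeometry.Motives.projectiveSpace 2 ℂ).left, IsClosed T ∧ T ≠ Set.univ ∧ Literature.AlgebraicGeometry.HodgeTheory.complexBetti.restrictCompl X (f.left.base ⁻¹' T) (2 * m) c = 0})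
    (hB : ∀ ⦃m : ℕ⦄, (∀ m' : ℕ, m' < m → ∀ ⦃X : Literature.AlgebraicGeometry.Motives.SchemeOver ℂ⦄, Literature.AlgebraicGeometry.Motives.IsSmoothProjective (2 * m') X → ∀ c : Literature.AlgebraicGeometry.HodgeTheory.complexBetti X (2 * m'), Literature.AlgebraicGeometry.HodgeTheory.IsRationalClass c → Literature.AlgebraicGeometry.HodgeTheory.IsOfHodgeType (2 * m') X (2 * m') m' m' c → c ∈ Literature.AlgebraicGeometry.HodgeTheory.algebraicClasses X m') → ∀ ⦃d : ℕ⦄, d < 2 * m → ∀ ⦃X : Literature.AlgebraicGeometry.Motives.SchemeOver ℂ⦄, Literature.AlgebraicGeometry.Motives.IsSmoothProjective d X → ∀ (p : ℕ) (c : Literature.AlgebraicGeometry.HodgeTheory.complexBetti X (2 * p)), Literature.AlgebraicGeometry.HodgeTheory.IsRationalClass c → Literature.AlgebraicGeometry.HodgeTheory.IsOfHodgeType d X (2 * p) p p c → c ∈ Literature.AlgebraicGeometry.HodgeTheory.algebraicClasses X p)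
    (hD : ∀ ⦃m : ℕ⦄, (∀ ⦃d : ℕ⦄, d < 2 * m → ∀ ⦃W : Literature.AlgebraicGeometry.Motives.SchemeOver ℂ⦄, Literature.AlgebraicGeometry.Motives.IsSmoothProjective d W → ∀ (p : ℕ) (b : Literature.AlgebraicGeometry.HodgeTheory.complexBetti W (2 * p)), Literature.AlgebraicGeometry.HodgeTheory.IsRationalClass b → Literature.AlgebraicGeometry.HodgeTheory.IsOfHodgeType d W (2 * p) p p b → b ∈ Literature.AlgebraicGeometry.HodgeTheory.algebraicClasses W p) → ∀ ⦃X : Literature.AlgebraicGeometry.Motives.SchemeOver ℂ⦄ (f : X ⟶ Literature.AlgebraicGeometry.Motives.projectiveSpace 2 ℂ), Literature.AlgebraicGeometry.Motives.IsSmoothProjective (2 * m) X → Function.Surjective f.left.base → Submodule.span ℂ {c : Literature.AlgebraicGeometry.HodgeTheory.complexBetti X (2 * m) | Literature.AlgebraicGeometry.HodgeTheory.IsRationalClass c ∧ Literature.AlgebraicGeometry.HodgeTheory.IsOfHodgeType (2 * m) X (2 * m) m m c ∧ ∃ T : Set (Literature.AlgebraicGeometry.Motives.projectiveSpace 2 ℂ).left,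 IsClosed T ∧ T ≠ Set.univ ∧ Literature.AlgebraicGeometry.HodgeTheory.complexBetti.restrictCompl X (f.left.base ⁻¹' T) (2 * m) c = 0} ≤ Literature.AlgebraicGeometry.HodgeTheory.algebraicClasses X m) :
    ∀ m : ℕ, 4 ≤ m →
      (∀ m' : ℕ, m' < m → ∀ ⦃X : SchemeOver ℂ⦄, IsSmoothProjective (2 * m') X →
        ∀ c : complexBetti X (2 * m'), IsRationalClass c →
          IsOfHodgeType (2 * m') X (2 * m') m' m' c → c ∈ algebraicClasses X m') →
      ∀ ⦃X : SchemeOver ℂ⦄, IsSmoothProjective (2 * m) X → ∀ c : complexBetti X (2 * m),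
        IsRationalClass c → IsOfHodgeType (2 * m) X (2 * m) m m c → c ∈ algebraicClasses X m := by
  have hV := higherVerticalClasses_of_stubs hB hD
  intro m hm ih Y hY c hc hpp
  obtain ⟨k, rfl⟩ : ∃ k, m = k + 1 := ⟨m - 1, by omega⟩
  have e : 2 + 2 * k = 2 * (k + 1) := by ring
  have hY' : IsSmoothProjective (2 + 2 * k) Y := e ▸ hY
  obtain ⟨N, -⟩ := exists_fiberNet_smoothBase_nonempty_holds (2 * k) 2 (by omega) hY'
  have htot : IsSmoothProjective (2 * (k + 1)) N.total := e ▸ N.isSmoothProjective_total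
  refine mem_algebraicClasses_of_isBirational htot hY N.blowDown
    (Summit.HodgeConjecture.HodgeConjecture.Theorems.isBirational_blowDown hY' N) ?_ c hc hpp
  intro c' hc' hpp'
  have hv := hV (show 3 ≤ k + 1 by omega) ih N.proj htot (FiberNet.surjective_proj N)
  have h1 := hN hm ih N.proj htot (FiberNet.surjective_proj N)
  exact (sup_le le_rfl hv) (h1 (Submodule.subset_span ⟨hc', hpp'⟩))

end Summit.HodgeConjecture.HodgeConjecture.Cruxes.SummitGrantedFourfolds.Birth

end
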